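import Summits.PneNP.PneNP.Theorems.OneSliceConstantBandTransferStepAux
import Literature.Computability.Complexity.RossmanMonotoneCliqueGraphs
import Literature.Computability.Complexity.CliqueThresholdBounds

/-!
# Near-clique contiguity on a critical slice (S2 of the line `flat-prior-relative-minterms`), part 1: counting

Counting tools on Hamming slices of the edge cube of `K_n` for the second-moment proof of
`NearCliqueContiguity` (crux `stmt-PneNP-2834`), on top of the slice toolkit of
`OneSliceConstantBandTransferStepAux.lean` (`ts_card_slice`, hypergeometric tail): the on/off hypergeometric count
`#{y ∈ slice_m : F ⊆ on(y), G ∩ on(y) = ∅} = C(C(n,2) - |G| - |F|, m - |F|)`, the hypergeometric tail, the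
falling-factorial identity `C(N-a-b, m-a)·[N]_{a+b} = C(N,m)·[m]_a·[N-m]_b` and its two consequences
(the pair/single ratio bound and the single-pattern lower bound). [folklore]
-/

noncomputable section

namespace Summit.PneNP.PneNP.Cruxes.ConstantBand.FlatPriorRelativeMinterms

set_option linter.dupNamespace false

open Literature.Computability.Complexity Filter Classical
open Finset hiding slice
open Literature.Combinatorics.SetFamily (finsetEquivFun mem_finsetEquivFun_symm)
open Summit.PneNP.PneNP.Theorems.ConstantBand.Negative

section Count

variable {n : ℕ}

/-- Membership in `edgesIn A` is `cliqueVec A e = true` (both endpoints in `A`). [folklore] -/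
theorem ncc_mem_edgesIn (A : Finset (Fin n)) (e : Edge n) : e ∈ edgesIn A ↔ cliqueVec A e = true := by
  rw [cliqueVec_eq_true_iff_endpts, edgesIn, mem_filter]
  exact ⟨fun h => h.2, fun h => ⟨mem_univ _, h⟩⟩

/-- `K_A` as a filter: the edges `e` with `cliqueVec A e = true`. [folklore] -/
theorem ncc_edgesIn_eq_filter (A : Finset (Fin n)) :
    edgesIn A = univ.filter fun e : Edge n => cliqueVec A e = true := by
  ext e
  rw [ncc_mem_edgesIn, mem_filter]
  exact ⟨fun h => ⟨mem_univ _, h⟩, fun h => h.2⟩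

/-- An edge inside both `A` and `B` forces `|A ∩ B| ≥ 2`. [folklore] -/
theorem ncc_two_le_card_inter {A B : Finset (Fin n)} {e : Edge n} (hA : e ∈ edgesIn A)
    (hB : e ∈ edgesIn B) : 2 ≤ #(A ∩ B) := by
  rw [edgesIn, mem_filter] at hA hB
  rw [← card_endpts e]
  exact card_le_card (subset_inter hA.2 hB.2)

/-- `K_A ∩ K_B = K_{A ∩ B}` as edge sets. [folklore] -/
theorem ncc_edgesIn_inter (A B : Finset (Fin n)) : edgesIn A ∩ edgesIn B = edgesIn (A ∩ B) := by
  ext e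
  simp only [edgesIn, mem_inter, mem_filter, mem_univ, true_and, subset_inter_iff]

/-- `#(K_A ∪ K_B) = C(|A|,2) + C(|B|,2) - C(|A ∩ B|,2)`. [folklore] -/
theorem ncc_card_edgesIn_union (A B : Finset (Fin n)) :
    #(edgesIn A ∪ edgesIn B) = (#A).choose 2 + (#B).choose 2 - (#(A ∩ B)).choose 2 := by
  have h := card_union_add_card_inter (edgesIn A) (edgesIn B)
  have hc : ∀ S : Finset (Fin n), #(edgesIn S) = (#S).choose 2 := fun S => by
    rw [ncc_edgesIn_eq_filter, card_filter_cliqueVec]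
  rw [ncc_edgesIn_inter, hc, hc, hc] at h
  omega

/-- **Counting tool.** The vectors of the slice `m` switching ON a fixed edge set `F` and OFF a disjoint
edge set `G` number `C(C(n,2) - |G| - |F|, m - |F|)` (choose the remaining `m - |F|` on-edges among the
free positions). [folklore] -/
theorem ncc_card_slice_onoff (F G : Finset (Edge n)) {m : ℕ} (hFG : Disjoint F G) (hF : #F ≤ m) :
    #((slice n m).filter fun y => (∀ e ∈ F, y e = true) ∧ ∀ e ∈ G, y e = false) =
      (n.choose 2 - #G - #F).choose (m - #F) := by
  have hsub : F ⊆ univ \ G := fun e he =>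
    mem_sdiff.2 ⟨mem_univ _, fun hg => disjoint_left.1 hFG he hg⟩
  rw [← card_edgeSet_top_fin n, ← card_univ (α := Edge n), ← card_sdiff_of_subset (subset_univ G),
    ← Finset.card_filter_powersetCard_subset F (univ \ G) m hsub hF]
  refine card_equiv (finsetEquivFun (α := Edge n)).symm fun y => ?_
  simp only [slice, mem_filter, mem_univ, true_and, mem_powersetCard, edgeCount,
    ts_finsetEquivFun_symm_eq]
  constructor
  · rintro ⟨hc, hF', hG'⟩
    refine ⟨⟨fun e he => ?_, hc⟩, fun e he => ?_⟩
    · rw [mem_filter] at he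
      refine mem_sdiff.2 ⟨mem_univ _, fun hg => ?_⟩
      rw [hG' e hg] at he
      exact Bool.false_ne_true he.2
    · exact mem_filter.2 ⟨mem_univ _, hF' e he⟩
  · rintro ⟨⟨hG', hc⟩, hF'⟩
    refine ⟨hc, fun e he => (mem_filter.1 (hF' he)).2, fun e he => ?_⟩
    cases h : y e
    · rfl
    · exact absurd he (mem_sdiff.1 (hG' (mem_filter.2 ⟨mem_univ _, h⟩))).2

/-- The counting tool as an inequality, with no hypothesis on `|F|`. [folklore] -/
theorem ncc_card_slice_onoff_le (F G : Finset (Edge n)) (m : ℕ) (hFG : Disjoint F G) :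
    #((slice n m).filter fun y => (∀ e ∈ F, y e = true) ∧ ∀ e ∈ G, y e = false) ≤
      (n.choose 2 - #G - #F).choose (m - #F) := by
  by_cases hF : #F ≤ m
  · exact (ncc_card_slice_onoff F G hFG hF).le
  · have h0 : ((slice n m).filter fun y => (∀ e ∈ F, y e = true) ∧ ∀ e ∈ G, y e = false) = ∅ := by
      refine filter_eq_empty_iff.2 fun y hy h => hF ?_
      rw [slice, mem_filter] at hy
      rw [← hy.2, edgeCount]
      exact card_le_card fun e he => mem_filter.2 ⟨mem_univ _, h.1 e he⟩
    rw [h0, card_empty]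
    exact Nat.zero_le _

/-- **Registered sub-goal of the Count file** (on/off counting on a slice, `∀`-form of
`ncc_card_slice_onoff`). [folklore] -/
theorem ncc_count_onoff :
    ∀ n m : ℕ, ∀ F G : Finset (Edge n), Disjoint F G → #F ≤ m →
      #((slice n m).filter fun y => (∀ e ∈ F, y e = true) ∧ ∀ e ∈ G, y e = false) =
        (n.choose 2 - #G - #F).choose (m - #F) :=
  fun _ _ F G hFG hF => ncc_card_slice_onoff F G hFG hF

end Count

/-! ## Falling-factorial identities for the on/off counts -/

section Binomial

/-- `C(N, m)·[m]_a = [N]_a·C(N - a, m - a)` (`a ≤ m`). [folklore] -/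
theorem ncc_choose_mul_descFactorial_left {N m a : ℕ} (ha : a ≤ m) :
    N.choose m * m.descFactorial a = N.descFactorial a * (N - a).choose (m - a) := by
  have h := Nat.choose_mul (n := N) ha
  calc N.choose m * m.descFactorial a = a.factorial * (N.choose m * m.choose a) := by
        rw [Nat.descFactorial_eq_factorial_mul_choose]; ring
    _ = a.factorial * (N.choose a * (N - a).choose (m - a)) := by rw [h]
    _ = N.descFactorial a * (N - a).choose (m - a) := by
        rw [Nat.descFactorial_eq_factorial_mul_choose]; ring

/-- `C(N - b, m)·[N]_b = C(N, m)·[N - m]_b`. [folklore] -/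
theorem ncc_choose_sub_mul_descFactorial (N m b : ℕ) :
    (N - b).choose m * N.descFactorial b = N.choose m * (N - m).descFactorial b := by
  by_cases h1 : m + b ≤ N
  · have h := ncc_choose_mul_descFactorial_left (N := N) (m := N - m) (a := b) (by omega)
    rw [Nat.choose_symm (by omega : m ≤ N)] at h
    rw [h, show N - m - b = (N - b) - m by omega, Nat.choose_symm (by omega : m ≤ N - b), mul_comm]
  · push Not at h1
    have hr : (N - m).descFactorial b = 0 ∨ N.choose m = 0 := by
      by_cases h2 : m ≤ N
      · exact Or.inl (Nat.descFactorial_of_lt (by omega))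
      · exact Or.inr (Nat.choose_eq_zero_of_lt (by omega))
    have hl : (N - b).choose m = 0 ∨ N.descFactorial b = 0 := by
      by_cases h3 : b ≤ N
      · exact Or.inl (Nat.choose_eq_zero_of_lt (by omega))
      · exact Or.inr (Nat.descFactorial_of_lt (by omega))
    rcases hl with h | h <;> rcases hr with h' | h' <;> simp [h, h']

/-- **The workhorse identity** of on/off counting on a slice:
`C(N - a - b, m - a)·[N]_{a+b} = C(N, m)·[m]_a·[N - m]_b` (`a ≤ m`), i.e.
`P_m[F on, G off] = [m]_{|F|}[N-m]_{|G|}/[N]_{|F|+|G|}`. [folklore] -/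
theorem ncc_onoff_identity (N m a b : ℕ) (ha : a ≤ m) :
    (N - a - b).choose (m - a) * N.descFactorial (a + b) =
      N.choose m * m.descFactorial a * (N - m).descFactorial b := by
  have E3 : N.descFactorial (a + b) = (N - a).descFactorial b * N.descFactorial a := by
    have := Nat.descFactorial_mul_descFactorial (n := N) (Nat.le_add_right a b)
    rw [Nat.add_sub_cancel_left] at this
    exact this.symm
  calc (N - a - b).choose (m - a) * N.descFactorial (a + b)
      = ((N - a - b).choose (m - a) * (N - a).descFactorial b) * N.descFactorial a := by
        rw [E3, mul_assoc]
    _ = ((N - a).choose (m - a) * (N - a - (m - a)).descFactorial b) * N.descFactorial a := by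
        rw [ncc_choose_sub_mul_descFactorial]
    _ = (N.descFactorial a * (N - a).choose (m - a)) * (N - m).descFactorial b := by
        rw [show N - a - (m - a) = N - m by omega]; ring
    _ = N.choose m * m.descFactorial a * (N - m).descFactorial b := by
        rw [← ncc_choose_mul_descFactorial_left ha]

/-- **Pair versus single patterns** (the `|A ∩ B| ≤ 1` term of the second moment):
`C(N,m)·C(N-2K, m-(2K-2))·[N-K]_K ≤ C(N-K, m-(K-1))²·[N]_K`, i.e.
`P[both]·/P[one]² ≤ [N]_K/[N-K]_K`. [folklore] -/
theorem ncc_pair_le_single_sq (N m K : ℕ) (hK : 1 ≤ K) (hKm : 2 * K - 2 ≤ m) (hKN : K ≤ N) :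
    N.choose m * (N - 2 * K).choose (m - (2 * K - 2)) * (N - K).descFactorial K ≤
      (N - K).choose (m - (K - 1)) ^ 2 * N.descFactorial K := by
  have h1 := ncc_onoff_identity N m (K - 1) 1 (by omega)
  rw [show N - (K - 1) - 1 = N - K by omega, show K - 1 + 1 = K by omega,
    Nat.descFactorial_one] at h1
  have h2 := ncc_onoff_identity N m (2 * K - 2) 2 hKm
  rw [show N - (2 * K - 2) - 2 = N - 2 * K by omega, show 2 * K - 2 + 2 = 2 * K by omega] at h2
  have h3 : N.descFactorial (2 * K) = (N - K).descFactorial K * N.descFactorial K := by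
    have := Nat.descFactorial_mul_descFactorial (n := N) (show K ≤ 2 * K by omega)
    rw [show 2 * K - K = K by omega] at this
    exact this.symm
  have h4 : m.descFactorial (2 * K - 2) ≤ m.descFactorial (K - 1) * m.descFactorial (K - 1) := by
    have := Nat.descFactorial_mul_descFactorial (n := m) (show K - 1 ≤ 2 * K - 2 by omega)
    rw [show 2 * K - 2 - (K - 1) = K - 1 by omega] at this
    rw [← this]
    exact Nat.mul_le_mul_right _ (Nat.descFactorial_le _ (Nat.sub_le _ _))
  have h5 : (N - m).descFactorial 2 ≤ (N - m) * (N - m) := by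
    have := Nat.descFactorial_le_pow (N - m) 2
    rwa [pow_two] at this
  have hpos : 0 < N.descFactorial K * N.descFactorial K :=
    Nat.mul_pos (Nat.descFactorial_pos.2 hKN) (Nat.descFactorial_pos.2 hKN)
  refine Nat.le_of_mul_le_mul_right ?_ hpos
  calc N.choose m * (N - 2 * K).choose (m - (2 * K - 2)) * (N - K).descFactorial K *
        (N.descFactorial K * N.descFactorial K)
      = N.choose m * N.descFactorial K *
          ((N - 2 * K).choose (m - (2 * K - 2)) * ((N - K).descFactorial K * N.descFactorial K)) := by
        ring
    _ = N.choose m * N.descFactorial K * (N.choose m * m.descFactorial (2 * K - 2) *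
          (N - m).descFactorial 2) := by rw [← h3, h2]
    _ = N.choose m * N.choose m * N.descFactorial K *
          (m.descFactorial (2 * K - 2) * (N - m).descFactorial 2) := by ring
    _ ≤ N.choose m * N.choose m * N.descFactorial K *
          (m.descFactorial (K - 1) * m.descFactorial (K - 1) * ((N - m) * (N - m))) :=
        Nat.mul_le_mul_left _ (Nat.mul_le_mul h4 h5)
    _ = (N.choose m * m.descFactorial (K - 1) * (N - m)) ^ 2 * N.descFactorial K := by ring
    _ = (N - K).choose (m - (K - 1)) ^ 2 * N.descFactorial K * (N.descFactorial K * N.descFactorial K) := by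
        rw [← h1]; ring

/-- **Single-pattern lower bound**: `C(N,m)·(m+2-K)^{K-1}·(N-m) ≤ C(N-K, m-(K-1))·N^K`, i.e.
`P[one pattern] ≥ ((m+2-K)/N)^{K-1}·(N-m)/N`. [folklore] -/
theorem ncc_single_ge (N m K : ℕ) (hK : 1 ≤ K) (hKm : K - 1 ≤ m) :
    N.choose m * (m + 2 - K) ^ (K - 1) * (N - m) ≤ (N - K).choose (m - (K - 1)) * N ^ K := by
  have h1 := ncc_onoff_identity N m (K - 1) 1 hKm
  rw [show N - (K - 1) - 1 = N - K by omega, show K - 1 + 1 = K by omega,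
    Nat.descFactorial_one] at h1
  have h2 : (m + 2 - K) ^ (K - 1) ≤ m.descFactorial (K - 1) := by
    have := Nat.pow_sub_le_descFactorial m (K - 1)
    rwa [show m + 1 - (K - 1) = m + 2 - K by omega] at this
  calc N.choose m * (m + 2 - K) ^ (K - 1) * (N - m)
      ≤ N.choose m * m.descFactorial (K - 1) * (N - m) :=
        Nat.mul_le_mul_right _ (Nat.mul_le_mul_left _ h2)
    _ = (N - K).choose (m - (K - 1)) * N.descFactorial K := h1.symm
    _ ≤ (N - K).choose (m - (K - 1)) * N ^ K :=
        Nat.mul_le_mul_left _ (Nat.descFactorial_le_pow N K)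

end Binomial

end Summit.PneNP.PneNP.Cruxes.ConstantBand.FlatPriorRelativeMinterms

end
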